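import Mathlib.RingTheory.Ideal.Maps
import Mathlib.Algebra.Algebra.Basic
import Literature.RingTheory.TightClosure.TightClosure
import Summits.ResolutionOfSingularities.ResolutionOfSingularities.Theorems.FrobeniusLadderFRationalResolutionRetract
import HarnessLib

/-!
# Frobenius-closedness descends along direct summands (crux `FInjectiveMacaulayfication`, E3)

Support file for crux stmt-ResolutionOfSingularities-15315 (`FrobeniusLadder.FInjectiveMacaulayfication`,
line `Sketch`): the "degree-zero / direct-summand DESCENT" certificate used by the weighted blow-up
engines. Let `A → B` be an algebra with an `A`-linear retraction `ρ : B → A`, `ρ 1 = 1` (so `A` is a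
direct summand of `B` as an `A`-module), both of exponential characteristic `p`, and let `I ⊆ A` be an
ideal whose extension `IB = I.map (algebraMap A B)` is Frobenius closed in `B`. Then `I` is Frobenius
closed in `A`.

Proof: if `y ^ q ∈ I^[q]` (`q = p ^ e`) then `algebraMap y ^ q ∈ (IB)^[q]` (the `q`-th powers of
elements of `I` map to `q`-th powers of elements of `IB`), so `algebraMap y ∈ IB` by hypothesis; the
retraction maps `IB = I • B` into `I` (it is `A`-linear) and `ρ (algebraMap y) = ρ (y • 1) = y`.
No primality, Noetherian, injectivity or domain hypothesis is needed. This is the Frobenius-closure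
analogue (witness `c = 1`) of the tight-closure statement "direct summands of weakly F-regular rings
are weakly F-regular" (Hochster–Huneke 1990, Prop. 4.12) recorded for the sibling crux
`FRationalResolution` (`…Theorems.FRationalResolution.weaklyFRegularClause_of_retract`), whose two
transport lemmas (`weaklyFRegularClause_of_retract_map_mem`: Frobenius-power brackets extend along
the algebra map; `weaklyFRegularClause_of_retract_rho_mem`: `ρ` maps `IB` into `I`) are reused here in
the `Literature.RingTheory.TightClosure` vocabulary (`frobeniusPower`, `frobeniusClosure`,
`IsFrobeniusClosed`; `frobeniusPower q I` is by definition the bracket `span {z ^ q | z ∈ I}`).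
No named facts.

## References

* [HochsterHuneke1990] M. Hochster, C. Huneke, *Tight closure, invariant theory, and the
  Briançon–Skoda theorem*, J. Amer. Math. Soc. 3 (1990), Prop. 4.12 (direct summands).
* [FedderWatanabe1989] R. Fedder, K.-i. Watanabe, *A characterization of F-regularity in terms of
  F-purity*, MSRI Publ. 15 (1989), Def. 1.5, Remark 1.9 (Frobenius closed ideals).
-/

-- single-problem summit: the doubled namespace component `ResolutionOfSingularities` is forced
set_option linter.dupNamespace false

namespace Summit.ResolutionOfSingularities.ResolutionOfSingularities.Theorems.FInjectiveMacaulayfication.Retract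

open Literature.RingTheory.TightClosure
open Summit.ResolutionOfSingularities.ResolutionOfSingularities.Theorems.FRationalResolution

/-- **Frobenius-closedness descends along direct summands** (E3 retract descent). Let `A → B` be an
algebra of rings of exponential characteristic `p` admitting an `A`-linear retraction `ρ : B → A` with
`ρ 1 = 1`, and let `I` be an ideal of `A` whose extension `I.map (algebraMap A B)` is Frobenius
closed in `B`. Then `I` is Frobenius closed in `A`: if `y ^ q ∈ I^[q]` then
`(algebraMap y) ^ q ∈ (IB)^[q]`, so `algebraMap y ∈ IB`, and `y = ρ (y • 1) = ρ (algebraMap y) ∈ I`.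
The Frobenius-closure analogue of Hochster–Huneke 1990, Prop. 4.12 (direct summands of weakly
F-regular rings). [folklore] -/
theorem frobeniusClosed_of_retract : ∀ (p : ℕ) (A B : Type) [CommRing A] [CommRing B] [Algebra A B] [ExpChar A p] [ExpChar B p] (ρ : B →ₗ[A] A), ρ 1 = 1 → ∀ I : Ideal A, Literature.RingTheory.TightClosure.IsFrobeniusClosed p (I.map (algebraMap A B)) → Literature.RingTheory.TightClosure.IsFrobeniusClosed p I := by
  intro p A B _ _ _ _ _ ρ hρ I hIB
  rw [isFrobeniusClosed_iff_le] at hIB ⊢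
  intro y hy
  obtain ⟨e, he⟩ := (mem_frobeniusClosure_iff p).mp hy
  have hy' : algebraMap A B y ∈ I.map (algebraMap A B) := by
    refine hIB ((mem_frobeniusClosure_iff p).mpr ⟨e, ?_⟩)
    rw [← map_pow]
    exact weaklyFRegularClause_of_retract_map_mem (S := B) I (p ^ e) he
  have h := weaklyFRegularClause_of_retract_rho_mem ρ I hy' 1
  rwa [one_mul, Algebra.algebraMap_eq_smul_one, map_smul, hρ, smul_eq_mul, mul_one] at h

end Summit.ResolutionOfSingularities.ResolutionOfSingularities.Theorems.FInjectiveMacaulayfication.Retract
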